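import Literature.Geometry.Riemannian.CheegerColdingExcessEstimate
import Literature.Geometry.Riemannian.AbreschGromollExcess
import Literature.Geometry.Lorentzian.HessianLocalMax
import HarnessLib

/-!
# Laplacian comparison for the distance function in the viscosity sense

Calabi 1958 / Cheeger–Colding 1996, §1: the Laplacian comparison `Δ d_p ≤ (m-1) coth d_p`
(`Ric ≥ -(m-1)`), `Δ d_p ≤ (m-1)/d_p` (`Ric ≥ 0`), `Δ d_p ≤ (m-1)κ coth(κ d_p)`
(`Ric ≥ -(m-1)κ²`) holds at EVERY point `x ≠ p` (cut locus included) in the barrier sense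
(`upper_barriers_edist`, `upper_barriers_edist_of_ricci_nonneg`, `upper_barriers_edist_scaled`),
hence in the **viscosity sense**: for every `C²` function `φ` touching `d_p` from below at `x`
(`d_p - φ` locally minimal at `x`), `Δφ(x)` obeys the same bound. We PROVE the general
principle "upper barriers ⇒ viscosity supersolution" (`laplaceBeltrami_le_of_upper_barriers`)
and the three corollaries. No definitions, no named facts (D-0026). Groundwork for
`CheegerColding1997_sphereStability`.

## References

* E. Calabi, Duke Math. J. 25 (1958) 45–56. [Calabi1958]
* J. Cheeger, T. H. Colding, Ann. of Math. 144 (1996) 189–237, §1. [CheegerColding1996]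
* M. G. Crandall, H. Ishii, P.-L. Lions, Bull. AMS 27 (1992) 1–67, §2 (viscosity solutions).
-/

noncomputable section

open Bundle Set Function Filter
open scoped Manifold ContDiff Topology ENNReal NNReal Real

namespace Literature.Geometry.Riemannian

open Lorentzian Lorentzian.PseudoRiemannianMetric

variable {E : Type*} [NormedAddCommGroup E] [NormedSpace ℝ E] [FiniteDimensional ℝ E]
  [CompleteSpace E] {M : Type*} [TopologicalSpace M] [ChartedSpace E M] [IsManifold 𝓘(ℝ, E) ∞ M]
  [T2Space M]
  (g : PseudoRiemannianMetric 𝓘(ℝ, E) ∞ E (TangentSpace 𝓘(ℝ, E) : M → Type _)) [g.HasLeviCivita]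
  [CovariantDerivative.ContMDiffCovariantDerivative g.leviCivita 1]
  [CovariantDerivative.ContMDiffCovariantDerivative g.leviCivita ∞]

omit [T2Space M] [CovariantDerivative.ContMDiffCovariantDerivative g.leviCivita 1]
  [CovariantDerivative.ContMDiffCovariantDerivative g.leviCivita ∞] in
/-- **Upper barriers imply the viscosity inequality** (Calabi 1958): if for every `ε > 0` the
function `u` admits a `C²` upper barrier `ψ_ε` at `x` (`u - ψ_ε` locally maximal at `x`) with
`Δψ_ε(x) ≤ B + ε`, then every `φ` of class `C²` at `x` touching `u` from below at `x`
(`u - φ` locally minimal at `x`) has `Δφ(x) ≤ B`: `φ - ψ_ε` has a local maximum at `x`, so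
`Δ(φ - ψ_ε)(x) ≤ 0`. [cite: Calabi1958, Thm. 1] -/
theorem laplaceBeltrami_le_of_upper_barriers (hg : g.IsRiemannian) {u : M → ℝ} {x : M} {B : ℝ}
    (hub : ∀ ε > 0, ∃ ψ : M → ℝ, (∀ᶠ x' in 𝓝 x, ContMDiffAt 𝓘(ℝ, E) 𝓘(ℝ, ℝ) 2 ψ x') ∧
      IsLocalMax (fun x' ↦ u x' - ψ x') x ∧ g.laplaceBeltrami ψ x ≤ B + ε)
    {φ : M → ℝ} (hφ : ContMDiffAt 𝓘(ℝ, E) 𝓘(ℝ, ℝ) 2 φ x)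
    (htouch : IsLocalMin (fun x' ↦ u x' - φ x') x) : g.laplaceBeltrami φ x ≤ B := by
  refine le_of_forall_pos_le_add fun ε hε ↦ ?_
  obtain ⟨ψ, hψs, hψmax, hψΔ⟩ := hub ε hε
  have hψ : ContMDiffAt 𝓘(ℝ, E) 𝓘(ℝ, ℝ) 2 ψ x := hψs.self_of_nhds
  -- `φ - ψ` has a local maximum at `x`
  have hlm : IsLocalMax (fun x' ↦ φ x' + (-1) * ψ x') x := by
    filter_upwards [hψmax, htouch] with z h1 h2
    have h1' : u z - ψ z ≤ u x - ψ x := h1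
    have h2' : u x - φ x ≤ u z - φ z := h2
    linarith
  have hsm : ContMDiffAt 𝓘(ℝ, E) 𝓘(ℝ, ℝ) 2 (fun x' ↦ φ x' + (-1) * ψ x') x :=
    hφ.add (contMDiffAt_const.mul hψ)
  have hΔ := g.dalembertian_nonpos_of_isLocalMax hsm hlm fun v hv ↦ hg x v hv
  rw [g.dalembertian_add_const_mul_of_contMDiffAt hφ hψ, ← laplaceBeltrami_eq_dalembertian,
    ← laplaceBeltrami_eq_dalembertian] at hΔ
  linarith

/-- **Laplacian comparison in the viscosity sense, `Ric ≥ -(m-1)`** (Calabi 1958;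
Cheeger–Colding 1996, §1): at every `x ≠ p`, every `C²` function `φ` touching `d_p` from below
at `x` satisfies `Δφ(x) ≤ (m-1) coth d(p, x)`. [cite: CheegerColding1996, §1]
[cite: Calabi1958, Thm. 1] -/
theorem laplaceBeltrami_le_coth_of_touching_edist_below [ConnectedSpace M] (hg : g.IsRiemannian)
    (hc : IsGeodesicallyComplete g.leviCivita)
    (hRic : ∀ (x : M) (w : TangentSpace 𝓘(ℝ, E) x),
      -((Module.finrank ℝ E : ℝ) - 1) * g.val x w w ≤ g.leviCivita.ricci x w w)
    {p x : M} (hxp : x ≠ p) {φ : M → ℝ} (hφ : ContMDiffAt 𝓘(ℝ, E) 𝓘(ℝ, ℝ) 2 φ x)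
    (htouch : IsLocalMin (fun x' ↦ (g.edist hg p x').toReal - φ x') x) :
    g.laplaceBeltrami φ x ≤ ((Module.finrank ℝ E : ℝ) - 1) *
      (Real.cosh (g.edist hg p x).toReal / Real.sinh (g.edist hg p x).toReal) :=
  laplaceBeltrami_le_of_upper_barriers g hg (upper_barriers_edist g hg hc hRic hxp) hφ htouch

/-- **Laplacian comparison in the viscosity sense, `Ric ≥ 0`**: at every `x ≠ p`, every `C²`
function `φ` touching `d_p` from below at `x` satisfies `Δφ(x) ≤ (m-1)/d(p, x)`.
[cite: CheegerColding1996, §1] [cite: Calabi1958, Thm. 1] -/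
theorem laplaceBeltrami_le_div_of_touching_edist_below [ConnectedSpace M] (hg : g.IsRiemannian)
    (hc : IsGeodesicallyComplete g.leviCivita)
    (hRic : ∀ (x : M) (w : TangentSpace 𝓘(ℝ, E) x), 0 ≤ g.leviCivita.ricci x w w)
    {p x : M} (hxp : x ≠ p) {φ : M → ℝ} (hφ : ContMDiffAt 𝓘(ℝ, E) 𝓘(ℝ, ℝ) 2 φ x)
    (htouch : IsLocalMin (fun x' ↦ (g.edist hg p x').toReal - φ x') x) :
    g.laplaceBeltrami φ x ≤ ((Module.finrank ℝ E : ℝ) - 1) * (1 / (g.edist hg p x).toReal) :=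
  laplaceBeltrami_le_of_upper_barriers g hg (upper_barriers_edist_of_ricci_nonneg g hg hc hRic hxp)
    hφ htouch

/-- **Laplacian comparison in the viscosity sense, `Ric ≥ -(m-1)κ²`, `κ > 0`**: at every
`x ≠ p`, every `C²` function `φ` touching `d_p` from below at `x` satisfies
`Δφ(x) ≤ (m-1) κ coth(κ d(p, x))`. [cite: CheegerColding1996, §1] [cite: Calabi1958, Thm. 1] -/
theorem laplaceBeltrami_le_coth_scaled_of_touching_edist_below [ConnectedSpace M]
    (hg : g.IsRiemannian) (hc : IsGeodesicallyComplete g.leviCivita) {κ : ℝ} (hκ : 0 < κ)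
    (hRic : ∀ (x : M) (w : TangentSpace 𝓘(ℝ, E) x),
      -((Module.finrank ℝ E : ℝ) - 1) * κ ^ 2 * g.val x w w ≤ g.leviCivita.ricci x w w)
    {p x : M} (hxp : x ≠ p) {φ : M → ℝ} (hφ : ContMDiffAt 𝓘(ℝ, E) 𝓘(ℝ, ℝ) 2 φ x)
    (htouch : IsLocalMin (fun x' ↦ (g.edist hg p x').toReal - φ x') x) :
    g.laplaceBeltrami φ x ≤ ((Module.finrank ℝ E : ℝ) - 1) * κ *
      (Real.cosh (κ * (g.edist hg p x).toReal) / Real.sinh (κ * (g.edist hg p x).toReal)) :=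
  laplaceBeltrami_le_of_upper_barriers g hg (upper_barriers_edist_scaled g hg hc hκ hRic hxp)
    hφ htouch

/-- **At points where `d_p` is itself `C²`** (e.g. off `{p} ∪ Cut(p)`), the viscosity
inequality is the classical one: `Δ d_p(x) ≤ (m-1) coth d(p, x)` under `Ric ≥ -(m-1)`
(take `φ = d_p`). [cite: CheegerColding1996, §1] -/
theorem laplaceBeltrami_edist_le_coth_of_contMDiffAt [ConnectedSpace M] (hg : g.IsRiemannian)
    (hc : IsGeodesicallyComplete g.leviCivita)
    (hRic : ∀ (x : M) (w : TangentSpace 𝓘(ℝ, E) x),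
      -((Module.finrank ℝ E : ℝ) - 1) * g.val x w w ≤ g.leviCivita.ricci x w w)
    {p x : M} (hxp : x ≠ p)
    (hd : ContMDiffAt 𝓘(ℝ, E) 𝓘(ℝ, ℝ) 2 (fun x' ↦ (g.edist hg p x').toReal) x) :
    g.laplaceBeltrami (fun x' ↦ (g.edist hg p x').toReal) x ≤ ((Module.finrank ℝ E : ℝ) - 1) *
      (Real.cosh (g.edist hg p x).toReal / Real.sinh (g.edist hg p x).toReal) :=
  laplaceBeltrami_le_coth_of_touching_edist_below g hg hc hRic hxp hd
    (Eventually.of_forall fun z ↦ by simp)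

end Literature.Geometry.Riemannian

end
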